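import Summits.Ventures.HodgeRepro2.T6A3Model

/-!
# T6-A3 — building an `EigenBasis` from one eigenvector per embedding

Tier 6 (README §10), sub-goal A3, seat t6-p3; proof lane.  The binder `E : EigenBasis K` of
`A3_main` (an enumeration `emb` of the embeddings by (real place, conjugation bit) and an
eigenvector basis `eB` of `H¹(B, ℂ)` spanning the interface's eigenlines) is assembled here from
the data A1 holds (t6-p1, `T6A1Complex`): a non-zero vector `eK σ` spanning each eigenline
`eigenLineK K σ` of `K ⊗ ℂ` (the six σ-eigenlines of the CM field), the spanning of `K ⊗ ℂ` by them
(`⨆ σ, eigenLineK K σ = ⊤`, TIER4 §A0.4), and an enumeration `emb` (the lead's composition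
contract, STATUS l. 4494).  `EigenBasis.ofLines` then has `eB (i, σ) = single i (eK σ)` — the form
A2's `A2_inputs` consumes (`heB`).  Nothing here is a display.
-/

open scoped TensorProduct

namespace Summit.Ventures.HodgeRepro2.T6.A3EigenBasis

open A3Model

variable {K : Type*} [Field K] [NumberField K]

/-- The vectors `eK σ` form a ℂ-basis of `K ⊗ ℂ` when they span it: there are `[K : ℚ]` of them
and `dim_ℂ (K ⊗ ℂ) = [K : ℚ]` (`NumberField.Embeddings.card`, `Module.finrank_baseChange`). -/
noncomputable def kcBasis (eK : (K →+* ℂ) → KC K) (hspan : Submodule.span ℂ (Set.range eK) = ⊤) :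
    Module.Basis (K →+* ℂ) ℂ (KC K) :=
  basisOfTopLeSpanOfCardEqFinrank eK (by rw [hspan]) (by
    rw [NumberField.Embeddings.card K ℂ]
    exact (Module.finrank_baseChange (R := ℂ) (S := ℚ) (M' := K)).symm)

/-- `kcBasis eK hspan σ = eK σ`. -/
theorem kcBasis_apply (eK : (K →+* ℂ) → KC K) (hspan : Submodule.span ℂ (Set.range eK) = ⊤)
    (σ : K →+* ℂ) : kcBasis eK hspan σ = eK σ := by
  unfold kcBasis
  rw [coe_basisOfTopLeSpanOfCardEqFinrank]

/-- The product basis `(i, σ) ↦ single i (eK σ)` of `H¹(B, ℂ) = (Fin 4 → K ⊗ ℂ)`. -/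
noncomputable def h1Basis (eK : (K →+* ℂ) → KC K) (hspan : Submodule.span ℂ (Set.range eK) = ⊤) :
    Module.Basis (Fin 4 × (K →+* ℂ)) ℂ (H1C K) :=
  (Pi.basis fun _ : Fin 4 => kcBasis eK hspan).reindex (Equiv.sigmaEquivProd (Fin 4) (K →+* ℂ))

/-- `h1Basis eK hspan (i, σ) = single i (eK σ)`. -/
theorem h1Basis_apply (eK : (K →+* ℂ) → KC K) (hspan : Submodule.span ℂ (Set.range eK) = ⊤)
    (i : Fin 4) (σ : K →+* ℂ) :
    h1Basis eK hspan (i, σ) = LinearMap.single ℂ (fun _ : Fin 4 => KC K) i (eK σ) := by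
  unfold h1Basis
  rw [Module.Basis.reindex_apply, Equiv.sigmaEquivProd_symm_apply, Pi.basis_apply, kcBasis_apply]
  rfl

/-- `eigenLine K i σ = ℂ ∙ single i (eK σ)` when `eigenLineK K σ = ℂ ∙ eK σ`. -/
theorem eigenLine_eq_span (eK : (K →+* ℂ) → KC K)
    (hline : ∀ σ, eigenLineK K σ = Submodule.span ℂ {eK σ}) (i : Fin 4) (σ : K →+* ℂ) :
    eigenLine K i σ = Submodule.span ℂ {LinearMap.single ℂ (fun _ : Fin 4 => KC K) i (eK σ)} := by
  unfold eigenLine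
  rw [hline σ, Submodule.map_span, Set.image_singleton]

/-- **`EigenBasis.ofLines`:** an `EigenBasis` from an enumeration `emb` of the embeddings and one
vector `eK σ` spanning each eigenline of `K ⊗ ℂ`, the `eK σ` spanning `K ⊗ ℂ` (A1's data). -/
noncomputable def ofLines (emb : Fin 3 × Bool ≃ (K →+* ℂ)) (eK : (K →+* ℂ) → KC K)
    (hline : ∀ σ, eigenLineK K σ = Submodule.span ℂ {eK σ})
    (hspan : Submodule.span ℂ (Set.range eK) = ⊤) : EigenBasis K where
  emb := emb
  eB := h1Basis eK hspan
  eigen := fun i σ => by rw [eigenLine_eq_span eK hline i σ, h1Basis_apply]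

/-- `(ofLines emb eK hline hspan).eB (i, σ) = single i (eK σ)` — the `heB` binder of `A2_inputs`. -/
theorem ofLines_eB (emb : Fin 3 × Bool ≃ (K →+* ℂ)) (eK : (K →+* ℂ) → KC K)
    (hline : ∀ σ, eigenLineK K σ = Submodule.span ℂ {eK σ})
    (hspan : Submodule.span ℂ (Set.range eK) = ⊤) (i : Fin 4) (σ : K →+* ℂ) :
    (ofLines emb eK hline hspan).eB (i, σ) = LinearMap.single ℂ (fun _ : Fin 4 => KC K) i (eK σ) :=
  h1Basis_apply eK hspan i σ

/-- `(ofLines emb …).emb = emb`. -/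
theorem ofLines_emb (emb : Fin 3 × Bool ≃ (K →+* ℂ)) (eK : (K →+* ℂ) → KC K)
    (hline : ∀ σ, eigenLineK K σ = Submodule.span ℂ {eK σ})
    (hspan : Submodule.span ℂ (Set.range eK) = ⊤) : (ofLines emb eK hline hspan).emb = emb := rfl

/-- A spanning family of lines with `⨆ σ, eigenLineK K σ = ⊤` spans `K ⊗ ℂ`. -/
theorem span_range_eq_top_of_iSup (eK : (K →+* ℂ) → KC K)
    (hline : ∀ σ, eigenLineK K σ = Submodule.span ℂ {eK σ})
    (htop : ⨆ σ, eigenLineK K σ = ⊤) : Submodule.span ℂ (Set.range eK) = ⊤ := by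
  rw [← htop]
  simp_rw [hline]
  rw [← Submodule.span_iUnion]
  congr 1
  ext v
  simp

end Summit.Ventures.HodgeRepro2.T6.A3EigenBasis
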